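import Mathlib
import Summits.NavierStokesRegularity.NavierStokesRegularity.Theorems.TaoLadderRungThreeRestartControl
import Summits.NavierStokesRegularity.NavierStokesRegularity.Theorems.TaoLadderRungThreeRestartGlue
import Summits.NavierStokesRegularity.NavierStokesRegularity.Theorems.TaoLadderRungThreeLocalDynamicsSufficesAt
import Summits.NavierStokesRegularity.NavierStokesRegularity.Theses.TaoLadderRungThree
import HarnessLib

/-!
# What a gap certificate proves BY ITSELF: exact-class blow-up of the certified table
  (helper for item stmt-NavierStokesRegularity-20422, crux K_A `DyadicGapCertificate` of route
  TaoLadderRungThree; also bears on K_A′ of route TaoLadderRungTwo)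

HONEST FRAMING: a structural lemma about Tao-type MODEL lattice flows (Tao 2016, §4/§6 cascade
class, cell vocabulary `TaoCascade.GapData` / `NoGlobalExactCascade` of the tree modules
`LocalCascadeSolutions` / `RestartedCascadeFlows`). It is an IMPLICATION from gap data; no gap datum
for any table is exhibited here (that is the open crux K_A), and nothing here is a statement about
the Navier–Stokes equations.

**Statement.** `GapData ε₀ i₀ α X₀ Z w r ρ θ₀ θ c₀ c env₀` with `X₀ i₀ ≠ 0` and `ε₀ > 0` implies
`NoGlobalExactCascade ε₀ α X₀`: the certified table admits NO global EXACT (`K₁ = K₂ = 0`)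
pseudo-solution from the one-shell datum, at every shell `n₀`. Corollary: the crux
`DyadicGapCertificate` ALONE already yields the exact (inviscid, defect-free) slice of the rung target
at the dyadic scale ratio — what the perturbation crux K_B (`GappedFrontRobust`) adds is exactly the
robustness under the Lemma 4.1 defects `K₁, K₂ > 0` (Theorem-4.2-level blow-up, `NoGlobalCascade`).

PROOF. Along a global exact solution `E = ½X²` ((4.10) with `K₂ = 0`), so the family restarted at a
checkpoint is a defect-free, zero-slack flow from a ball state with start energies `½S₀²`
(`RestartControl.pseudoFlowOn_restart` at `K₁ = K₂ = η = 0`) on the horizon `c₀`; the certificate's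
own clause (step₀) steps it into the `ρr`-ball ⊆ `r`-ball within `c₀` with ratio `≥ (1+ε₀)^{-θ₀}`;
`RestartGlue` turns the step into the next epoch checkpoint; induction on the level
(`LocalDynamicsSufficesAt.forall_exists_epochCheckpoints`) gives checkpoints at every level, which
contradict (4.5) (`CascadeODESolutionFrom.false_of_shellCheckpoints`, `θ₀ < 5/2`, `c₀ ≥ 0`).
-/

noncomputable section

-- the sub-problem namespace `Summit.NavierStokesRegularity.NavierStokesRegularity` repeats the summit name by design (D-0017)
set_option linter.dupNamespace false

namespace Summit.NavierStokesRegularity.NavierStokesRegularity.Theorems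

open Set MeasureTheory intervalIntegral Literature.Analysis.FluidPDE Literature.Analysis.FluidPDE.TaoCascade

namespace GapDataExact

variable {ε₀ : ℝ} {m : ℕ} {i₀ : Fin m} {α : Fin m → Fin m → Fin m → ℤ × ℤ × ℤ → ℝ}
  {X₀ : Fin m → ℝ} {Z : Set (Fin m → ℤ → ℝ)} {w : ℤ → ℝ} {r ρ θ₀ θ c₀ c : ℝ} {env₀ : ℤ → ℝ}

/-- The ball description is monotone in the radius. [cite: Tao2016AveragedNS, §6.2 Prop. 6.3 (viii); cell vocabulary] -/
theorem ballDesc_mono {r r' : ℝ} (hrr' : r ≤ r') {S F : Fin m → ℤ → ℝ} (h : ballDesc Z w r S F) :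
    ballDesc Z w r' S F := by
  obtain ⟨z, hz, hzr⟩ := h
  exact ⟨z, hz, fun i k => (hzr i k).trans hrr'⟩

/-- A checkpoint step is monotone in the transition-state description.
[cite: Tao2016AveragedNS, §6.4 Prop. 6.5 (conclusion); cell vocabulary] -/
theorem stepTo_mono {θ' c' : ℝ} {P P' Q : (Fin m → ℤ → ℝ) → (Fin m → ℤ → ℝ) → Prop}
    (hPP' : ∀ S F, P S F → P' S F) {S F : Fin m → ℤ → ℝ → ℝ} {τ₁ a : ℝ}
    (h : StepTo ε₀ θ' c' i₀ P Q S F τ₁ a) : StepTo ε₀ θ' c' i₀ P' Q S F τ₁ a := by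
  obtain ⟨h1, h2, h3, h4, h5, h6, h7⟩ := h
  exact ⟨h1, h2, h3, h4, h5, hPP' _ _ h6, h7⟩

/-- Along an EXACT local pseudo-solution (`K₂ = 0`) the local energies are `E = ½X²`.
[cite: Tao2016AveragedNS, §4 (4.10) and (4.12)] -/
theorem energy_eq_of_exact {T K₁ : ℝ} {n₀ : ℤ} {X E : Fin m → ℤ → ℝ → ℝ}
    (hsol : CascadeODESolutionOn T ε₀ α K₁ 0 n₀ X₀ X E) (i : Fin m) (n : ℤ) {t : ℝ}
    (ht : t ∈ Icc 0 T) : E i n t = (1 / 2) * X i n t ^ 2 := by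
  have h1 := hsol.defect_lower i n t ht
  have h2 := hsol.defect_upper i n t ht
  simp only [zero_mul, add_zero] at h2
  exact le_antisymm h2 h1

/-- **The inductive step along a global exact solution**: epoch checkpoints (ratio exponent `θ₀`,
clock `c₀`, description = the `r`-ball, epoch envelope `env₀`) up to level `N` extend to level
`N+1` — restart (defect-free, zero slack), apply the certificate's (step₀), glue.
[cite: Tao2016AveragedNS, §6.3–6.4 Props. 6.4–6.5 (the inductive step), here for exact flows] -/
theorem step (hε₀ : 0 < ε₀) (hgap : GapData ε₀ i₀ α X₀ Z w r ρ θ₀ θ c₀ c env₀) {n₀ N : ℤ}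
    {X E : Fin m → ℤ → ℝ → ℝ} (hsol : CascadeODESolutionFrom ε₀ α 0 0 n₀ X₀ X E) (hN : n₀ ≤ N)
    {t e : ℤ → ℝ}
    (h : EpochCheckpoints ε₀ θ₀ c₀ i₀ n₀ X₀ (ballDesc Z w r) (epochEnvelope env₀) N X E t e) :
    ∃ s a : ℝ, EpochCheckpoints ε₀ θ₀ c₀ i₀ n₀ X₀ (ballDesc Z w r) (epochEnvelope env₀) (N + 1) X E
      (Function.update t (N + 1) s) (Function.update e (N + 1) a) := by
  obtain ⟨hr, hρ0, hρ1, -, hθ₀θ, hθ, hc₀, -, -, -, -, -, hstep₀⟩ := hgap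
  have hq : (0 : ℝ) < 1 + ε₀ := by linarith
  have heN : 0 < e N := h.e_pos N hN le_rfl
  have htN0 : 0 ≤ t N := h.t_nonneg N hN le_rfl
  set γ : ℝ := e N * (1 + ε₀) ^ ((5 : ℝ) * N / 2) with hγ
  have hγpos : 0 < γ := mul_pos heN (Real.rpow_pos_of_pos hq _)
  set T : ℝ := t N + c₀ / γ with hT
  have hcγ : 0 < c₀ / γ := div_pos hc₀ hγpos
  have hTpos : 0 < T := by linarith
  have htT : t N < T := by linarith
  have hsolT := hsol.restrict hTpos
  -- the restarted family is a defect-free flow (`K₁ = K₂ = η = 0`)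
  have h0 : (0 : ℝ) ≤ 0 * |X₀ i₀| * (1 + ε₀) ^ ((n₀ : ℝ) / 2) := by simp
  have hflow := RestartControl.pseudoFlowOn_restart hε₀ (hθ₀θ.le.trans hθ) le_rfl le_rfl h0 h0 hsolT
    hN h.toShellCheckpoints htT
  -- its horizon is `c₀`, its slack vanishes and its start energies are `½S₀²`
  have hτ : (T - t N) * γ = c₀ := by rw [hT]; field_simp; ring
  have hB : restartSlack ε₀ 0 N (t N) (e N) E = fun _ _ => 0 := by
    funext i k; simp [restartSlack]
  have hF : (fun i k => E i (N + k) (t N) / e N ^ 2) =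
      fun i k => (1 / 2) * (X i (N + k) (t N) / e N) ^ 2 := by
    funext i k
    rw [energy_eq_of_exact hsolT i (N + k) ⟨htN0, htT.le⟩]
    ring
  rw [hτ, hB, hF] at hflow
  -- the certificate's clause (step₀)
  have hball : ballDesc Z w r (fun i k => X i (N + k) (t N) / e N)
      (fun i k => (1 / 2) * (X i (N + k) (t N) / e N) ^ 2) := by
    obtain ⟨z, hz, hzr⟩ := h.state N hN le_rfl
    exact ⟨z, hz, hzr⟩
  obtain ⟨τ₁, a, hst⟩ := hstep₀ _ c₀ _ _ hball le_rfl hflow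
  have hst' : StepTo ε₀ θ₀ c₀ i₀ (ballDesc Z w r) (epochEnvelope env₀)
      (restartX ε₀ N (t N) (e N) X) (restartE ε₀ N (t N) (e N) E) τ₁ a :=
    stepTo_mono (fun S F hS => ballDesc_mono (mul_le_of_le_one_left hr.le hρ1.le) hS) hst
  exact ⟨_, _, RestartGlue.epochCheckpoints_succ hε₀ hN h hst'⟩

/-- **A gap certificate proves exact-class blow-up of its table**: `GapData … ⇒
NoGlobalExactCascade ε₀ α X₀` (no global exact pseudo-solution from the one-shell datum at any
shell). [cite: Tao2016AveragedNS, §6.2 p. 32 (Thm. 6.2 from Props. 6.3–6.4), here for exact flows; cell vocabulary] -/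
theorem noGlobalExactCascade_of_gapData (hε₀ : 0 < ε₀) (hX₀ : X₀ i₀ ≠ 0)
    (hgap : GapData ε₀ i₀ α X₀ Z w r ρ θ₀ θ c₀ c env₀) : NoGlobalExactCascade ε₀ α X₀ := by
  refine ⟨0, fun n₀ _ => ?_⟩
  rintro ⟨X, E, hsol⟩
  obtain ⟨-, -, -, -, hθ₀θ, hθ, hc₀, -, -⟩ := hgap.signs
  have hθ₀ : θ₀ < 5 / 2 := by linarith
  have hP : ballDesc Z w r (datumState i₀ X₀) (datumEnergy i₀ X₀) := hgap.datum_mem_ball _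
  have hall := LocalDynamicsSufficesAt.forall_exists_epochCheckpoints (θ := θ₀) (c := c₀)
    (P := ballDesc Z w r) (Q := epochEnvelope env₀) hε₀ hc₀ hsol hX₀ hP
    (fun T _ _ N hN t e h _ => step hε₀ hgap hsol hN h)
  exact hsol.false_of_shellCheckpoints hε₀ hθ₀ hc₀.le fun N hN => by
    obtain ⟨t, e, h⟩ := hall N hN
    exact ⟨t, e, h.forget⟩

end GapDataExact

open Summit.NavierStokesRegularity.NavierStokesRegularity.Theses.TaoLadderRungThree in
/-- **K_A alone gives the exact slice of the rung target** (route TaoLadderRungThree):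
`DyadicGapCertificate` implies that some comparable table and one-shell datum have NO global exact
cascade solution at the dyadic scale ratio (`NoGlobalExactCascade 1 α X₀`). The rung target asks for
`NoGlobalCascade` (all defects `K₁, K₂ ≥ 0`), which needs the perturbation crux K_B in addition.
[cite: Tao2016AveragedNS, §4 Thm. 4.2 and (4.12); cell vocabulary] -/
theorem taoLadderRungThree_exactBlowup_of_dyadicGapCertificate (hA : DyadicGapCertificate) :
    ∃ R : ℝ, 1 ≤ R ∧ ∃ (α : Fin 4 → Fin 4 → Fin 4 → ℤ × ℤ × ℤ → ℝ) (X₀ : Fin 4 → ℝ),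
      InTableClass R α ∧ NoGlobalExactCascade 1 α X₀ := by
  obtain ⟨R, i₀, α, X₀, Z, w, r, ρ, θ₀, θ, c₀, c, env₀, hR, hα, hX₀, hgap⟩ := hA
  exact ⟨R, hR, α, X₀, hα, GapDataExact.noGlobalExactCascade_of_gapData one_pos hX₀ hgap⟩

end Summit.NavierStokesRegularity.NavierStokesRegularity.Theorems

end
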